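import Mathlib.Analysis.SpecialFunctions.Pow.Real

/-!
HONEST FRAMING: exact (Metropolis-corrected) sampling algorithms for lattice gauge theory; figures
of merit are autocorrelation/cost numbers at stated couplings and volumes; no continuum-physics
claim.

# CompositionDistanceRedraw — THE MULTISET DISTANCE OF TWO COMPOSITIONS UNDER ONE DELETION EACH AND A COMMON INSERTION:
# `Δ(M_X + δ_a, M_Y + δ_b) + 𝟙{b ∉ B} = Δ(M_X, M_Y) + 𝟙{a ∈ A}` (`a ≠ b`), `Δ(M + δ_z, M' + δ_z) = Δ(M, M')` (lean-2 GEN-35, ours)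

Venture-side (OURS).  Cell `lqcd-flow` (pub-lqcd), unit `pub-lqcd-lean-2-g35`, 2026-08-29.  Chapter V (OPEN-MATH-chapterM item 1 (i) at FAST swaps, in
COMPOSITION VARIABLES), file 1: pure combinatorics on `S → ℕ`, no chain.  For the homogeneous `q`-content star (persistent hub with exact redraws, `K` idle
cold levels of one law, identity maps, uniform entry list) the FULL composition `N : S → ℕ` of one copy — the number of particles of each content among the
`K + 1` positions, hub included — is invariant inside a refresh cycle (swaps permute positions) and moves at the redraw by `−δ_(hub content) + δ_(fresh content)`.
For two copies that receive the SAME fresh content `z`, the one-sided multiset distance `Δ(N_X, N_Y) = Σ_v (N_X(v) − N_Y(v))⁺` (truncated subtraction in `ℕ`)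
therefore changes only at redraws, and this file computes the change exactly: writing the pre-redraw compositions as `N_X = M_X + δ_a`, `N_Y = M_Y + δ_b`
(`a`, `b` the two hub contents at the redraw, `M` the survivors), the post-redraw distance is `Δ(M_X + δ_z, M_Y + δ_z) = Δ(M_X, M_Y)` and
`Δ(M_X, M_Y) = Δ(N_X, N_Y) − 𝟙{a ∈ A} + 𝟙{b ∉ B}` for `a ≠ b` (`A = {N_X > N_Y}` the `X`-surplus contents, `B = {N_Y > N_X}`), `= Δ(N_X, N_Y)` for `a = b`.
Hypothesis-equation for `Δ` (`hΔ`), no definitions.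

## What is proved

* §1 `cdist_self`, `cdist_eq_zero_iff` (`Δ(N,N') = 0 ↔ N ≤ N'`), `cdist_cast_sub` (`(Δ(N,N') : ℤ) − Δ(N',N) = Σ_v (N(v) − N'(v))` in `ℤ`), **`cdist_symm_of_sum_eq`** (equal totals ⇒
  `Δ(N,N') = Δ(N',N)`), `eq_of_cdist_eq_zero` (equal totals and `Δ = 0` ⇒ `N = N'`), `cdist_le_sum` (`Δ(N,N') ≤ Σ_v N(v)`).
* §2 **`cdist_add_single_same`** — a common insertion (or a common deletion) does not change `Δ`.
* §3 **`cdist_add_single_add_single`** — the `±1` rule for `a ≠ b`: `Δ(M + δ_a, M' + δ_b) + 𝟙{M'(b) + 1 ≤ M(b)} = Δ(M, M') + 𝟙{M'(a) ≤ M(a)}`, and its signed form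
  **`cdist_survivors_int`**: `(Δ(M,M') : ℤ) = Δ(M + δ_a, M' + δ_b) − 𝟙{M'(a) ≤ M(a)} + 𝟙{M'(b) + 1 ≤ M(b)}` — in the words above `−𝟙{a ∈ A} + 𝟙{b ∉ B}`; hence
  `cdist_survivors_le_add_one`, `cdist_survivors_le_of_mem` ∕ `'` (`a ∈ A` or `b ∈ B` ⇒ `Δ` does not increase), `cdist_survivors_of_mem_of_mem` (`a ∈ A`, `b ∈ B` ⇒ `Δ`
  drops by exactly one).
* §4 **`cdist_expect_eq`** — for any non-negative kernel `π(a,b)` on the pairs of deleted contents with row marginal `u_X` and column marginal `u_Y` (total mass `1`):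
  `Σ_{a,b} π(a,b)·Δ(M^a_X, M^b_Y) = Δ(N_X,N_Y) − Σ_a u_X(a)𝟙{a ∈ A} + Σ_b u_Y(b)𝟙{b ∉ B} − Σ_c π(c,c)𝟙{c ∉ A ∪ B}`, where `M^a` denotes the survivors
  (`N = M^a + δ_a` whenever `u(a) ≠ 0`, hypothesis-equations `hMX`, `hMY`).

Reading (no numerics implied): §4 is the composition-variable «bracket» of one refresh cycle for ANY coupling of the two cycle-end hub contents (file 2 maximises the last
term; file 3 evaluates it for the `τ = ∞` urn).  NOT CLAIMED: anything about the star's kernel — this file is bookkeeping.  Literature grade (cell rule): OWN, elementary;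
nothing cited as a fact; no new bib keys.
-/

open Finset

namespace Summit.Ventures.LatticeQCDFlow.Scaling

section CDist
variable {S : Type*} [Fintype S] [DecidableEq S] {Δ : (S → ℕ) → (S → ℕ) → ℕ}

/-! ## §1 The one-sided multiset distance -/

omit [DecidableEq S] in
/-- `Δ(N, N) = 0`. [ours] -/
theorem cdist_self (hΔ : ∀ N N', Δ N N' = ∑ v, (N v - N' v)) (N : S → ℕ) : Δ N N = 0 := by
  rw [hΔ]; simp

omit [DecidableEq S] in
/-- `Δ(N, N') = 0 ↔ N ≤ N'` pointwise. [ours] -/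
theorem cdist_eq_zero_iff (hΔ : ∀ N N', Δ N N' = ∑ v, (N v - N' v)) (N N' : S → ℕ) : Δ N N' = 0 ↔ ∀ v, N v ≤ N' v := by
  rw [hΔ, Finset.sum_eq_zero_iff]
  exact ⟨fun h v => Nat.sub_eq_zero_iff_le.mp (h v (mem_univ v)), fun h v _ => Nat.sub_eq_zero_iff_le.mpr (h v)⟩

omit [DecidableEq S] in
/-- The two one-sided distances differ by the difference of the totals: `(Δ(N,N') : ℤ) − Δ(N',N) = Σ_v (N(v) − N'(v))` in `ℤ`. [ours] -/
theorem cdist_cast_sub (hΔ : ∀ N N', Δ N N' = ∑ v, (N v - N' v)) (N N' : S → ℕ) :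
    (Δ N N' : ℤ) - (Δ N' N : ℤ) = ∑ v, ((N v : ℤ) - (N' v : ℤ)) := by
  rw [hΔ, hΔ, Nat.cast_sum, Nat.cast_sum, ← Finset.sum_sub_distrib]
  refine sum_congr rfl fun v _ => ?_
  omega

omit [DecidableEq S] in
/-- **Equal totals ⇒ the distance is symmetric:** `Σ_v N(v) = Σ_v N'(v) ⇒ Δ(N,N') = Δ(N',N)`. [ours] -/
theorem cdist_symm_of_sum_eq (hΔ : ∀ N N', Δ N N' = ∑ v, (N v - N' v)) {N N' : S → ℕ} (h : ∑ v, N v = ∑ v, N' v) :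
    Δ N N' = Δ N' N := by
  have h1 := cdist_cast_sub hΔ N N'
  have h2 : ∑ v, ((N v : ℤ) - (N' v : ℤ)) = 0 := by
    rw [Finset.sum_sub_distrib, ← Nat.cast_sum, ← Nat.cast_sum, h, sub_self]
  rw [h2] at h1
  exact_mod_cast sub_eq_zero.mp h1

omit [DecidableEq S] in
/-- Equal totals and `Δ(N,N') = 0` force `N = N'`. [ours] -/
theorem eq_of_cdist_eq_zero (hΔ : ∀ N N', Δ N N' = ∑ v, (N v - N' v)) {N N' : S → ℕ} (h : ∑ v, N v = ∑ v, N' v) (h0 : Δ N N' = 0) :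
    N = N' := by
  have h0' : Δ N' N = 0 := by rw [← cdist_symm_of_sum_eq hΔ h]; exact h0
  rw [cdist_eq_zero_iff hΔ] at h0 h0'
  exact funext fun v => le_antisymm (h0 v) (h0' v)

omit [DecidableEq S] in
/-- `Δ(N,N') ≤ Σ_v N(v)` (the distance never exceeds the number of particles). [ours] -/
theorem cdist_le_sum (hΔ : ∀ N N', Δ N N' = ∑ v, (N v - N' v)) (N N' : S → ℕ) : Δ N N' ≤ ∑ v, N v := by
  rw [hΔ]; exact sum_le_sum fun v _ => Nat.sub_le _ _

/-! ## §2 A common insertion does not change the distance -/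

/-- **`Δ(M + δ_z, M' + δ_z) = Δ(M, M')`:** adding the same fresh content to both compositions (or removing a common content from both) leaves the distance unchanged. [ours] -/
theorem cdist_add_single_same (hΔ : ∀ N N', Δ N N' = ∑ v, (N v - N' v)) (M M' : S → ℕ) (z : S) :
    Δ (M + Pi.single z 1) (M' + Pi.single z 1) = Δ M M' := by
  rw [hΔ, hΔ]
  refine sum_congr rfl fun v _ => ?_
  simp only [Pi.add_apply, Pi.single_apply]
  split_ifs <;> omega

/-! ## §3 The `±1` rule for two different deleted contents -/

omit [Fintype S] in
/-- Pointwise form of the `±1` rule. [ours] -/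
theorem cdist_pointwise_add_single (M M' : S → ℕ) {a b : S} (hab : a ≠ b) (v : S) :
    ((M + Pi.single a 1 : S → ℕ) v - (M' + Pi.single b 1 : S → ℕ) v) + (if M' b + 1 ≤ M b then (Pi.single b 1 : S → ℕ) v else 0)
      = (M v - M' v) + (if M' a ≤ M a then (Pi.single a 1 : S → ℕ) v else 0) := by
  simp only [Pi.add_apply, Pi.single_apply]
  by_cases hva : v = a
  · subst hva; simp only [if_true, if_neg hab]; split_ifs <;> omega
  · by_cases hvb : v = b
    · subst hvb; simp only [if_true, if_neg hva]; split_ifs <;> omega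
    · simp only [if_neg hva, if_neg hvb]; split_ifs <;> omega

/-- **THE `±1` RULE** (`a ≠ b`): `Δ(M + δ_a, M' + δ_b) + 𝟙{M'(b) + 1 ≤ M(b)} = Δ(M, M') + 𝟙{M'(a) ≤ M(a)}`.  With `N = M + δ_a`, `N' = M' + δ_b`: `M'(a) ≤ M(a) ↔ N(a) > N'(a)`
(`a ∈ A`) and `M'(b) + 1 ≤ M(b) ↔ N'(b) ≤ N(b)` (`b ∉ B`). [ours] -/
theorem cdist_add_single_add_single (hΔ : ∀ N N', Δ N N' = ∑ v, (N v - N' v)) (M M' : S → ℕ) {a b : S} (hab : a ≠ b) :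
    Δ (M + Pi.single a 1) (M' + Pi.single b 1) + (if M' b + 1 ≤ M b then 1 else 0)
      = Δ M M' + (if M' a ≤ M a then 1 else 0) := by
  have hpt := fun v => cdist_pointwise_add_single M M' hab v
  have hsum := Finset.sum_congr rfl fun v (_ : v ∈ (univ : Finset S)) => hpt v
  rw [sum_add_distrib, sum_add_distrib] at hsum
  have hb : ∑ v, (if M' b + 1 ≤ M b then (Pi.single b 1 : S → ℕ) v else 0) = if M' b + 1 ≤ M b then 1 else 0 := by
    split_ifs
    · rw [Finset.sum_pi_single']; simp
    · simp
  have ha : ∑ v, (if M' a ≤ M a then (Pi.single a 1 : S → ℕ) v else 0) = if M' a ≤ M a then 1 else 0 := by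
    split_ifs
    · rw [Finset.sum_pi_single']; simp
    · simp
  rw [hb, ha, ← hΔ, ← hΔ] at hsum
  exact hsum

/-- **Signed form:** `(Δ(M, M') : ℤ) = Δ(M + δ_a, M' + δ_b) − 𝟙{M'(a) ≤ M(a)} + 𝟙{M'(b) + 1 ≤ M(b)}` for `a ≠ b` — the survivors' distance is the pre-redraw distance
`−𝟙{a ∈ A} + 𝟙{b ∉ B}`. [ours] -/
theorem cdist_survivors_int (hΔ : ∀ N N', Δ N N' = ∑ v, (N v - N' v)) (M M' : S → ℕ) {a b : S} (hab : a ≠ b) :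
    (Δ M M' : ℤ) = (Δ (M + Pi.single a 1) (M' + Pi.single b 1) : ℤ) - (if M' a ≤ M a then 1 else 0) + (if M' b + 1 ≤ M b then 1 else 0) := by
  have h := cdist_add_single_add_single hΔ M M' hab
  have h' : ((Δ (M + Pi.single a 1) (M' + Pi.single b 1) + (if M' b + 1 ≤ M b then 1 else 0) : ℕ) : ℤ)
      = ((Δ M M' + (if M' a ≤ M a then 1 else 0) : ℕ) : ℤ) := by rw [h]
  push_cast at h'
  split_ifs at h' ⊢ <;> linarith

/-- The survivors' distance exceeds the pre-redraw distance by at most one. [ours] -/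
theorem cdist_survivors_le_add_one (hΔ : ∀ N N', Δ N N' = ∑ v, (N v - N' v)) (M M' : S → ℕ) (a b : S) :
    Δ M M' ≤ Δ (M + Pi.single a 1) (M' + Pi.single b 1) + 1 := by
  by_cases hab : a = b
  · subst hab; rw [cdist_add_single_same hΔ]; exact Nat.le_succ _
  · have h := cdist_add_single_add_single hΔ M M' hab
    split_ifs at h <;> omega

/-- **If the first copy deletes a surplus content (`a ∈ A`, i.e. `M'(a) ≤ M(a)`), the distance does not increase.** [ours] -/
theorem cdist_survivors_le_of_mem (hΔ : ∀ N N', Δ N N' = ∑ v, (N v - N' v)) (M M' : S → ℕ) {a : S} (b : S) (ha : M' a ≤ M a) :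
    Δ M M' ≤ Δ (M + Pi.single a 1) (M' + Pi.single b 1) := by
  by_cases hab : a = b
  · subst hab; rw [cdist_add_single_same hΔ]
  · have h := cdist_add_single_add_single hΔ M M' hab
    rw [if_pos ha] at h
    split_ifs at h <;> omega

/-- **If the second copy deletes one of ITS surplus contents (`b ∈ B`, i.e. `M(b) ≤ M'(b)`), the distance does not increase.** [ours] -/
theorem cdist_survivors_le_of_mem' (hΔ : ∀ N N', Δ N N' = ∑ v, (N v - N' v)) (M M' : S → ℕ) (a : S) {b : S} (hb : M b ≤ M' b) :
    Δ M M' ≤ Δ (M + Pi.single a 1) (M' + Pi.single b 1) := by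
  by_cases hab : a = b
  · subst hab; rw [cdist_add_single_same hΔ]
  · have h := cdist_add_single_add_single hΔ M M' hab
    have hnb : ¬ (M' b + 1 ≤ M b) := by omega
    rw [if_neg hnb] at h
    split_ifs at h <;> omega

/-- **If the first copy deletes a content of `A` and the second one of `B` (two different contents), the distance drops by exactly one.** [ours] -/
theorem cdist_survivors_of_mem_of_mem (hΔ : ∀ N N', Δ N N' = ∑ v, (N v - N' v)) (M M' : S → ℕ) {a b : S} (hab : a ≠ b) (ha : M' a ≤ M a)
    (hb : M b ≤ M' b) : Δ M M' + 1 = Δ (M + Pi.single a 1) (M' + Pi.single b 1) := by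
  have h := cdist_add_single_add_single hΔ M M' hab
  have hnb : ¬ (M' b + 1 ≤ M b) := by omega
  rw [if_neg hnb, if_pos ha, add_zero] at h
  exact h.symm

/-! ## §4 The expected survivors' distance under a coupling of the two deleted contents -/

/-- **THE COMPOSITION BRACKET FOR ANY COUPLING.**  Let `π(a,b) ≥ 0` be a kernel on the pairs of deleted contents with row sums `u_X(a)`, column sums `u_Y(b)` and total mass `1`,
and let `M^a_X`, `M^b_Y` be the survivors (`N_X = M^a_X + δ_a` whenever `u_X(a) ≠ 0`, `N_Y = M^b_Y + δ_b` whenever `u_Y(b) ≠ 0`).  Then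
`Σ_{a,b} π(a,b)·Δ(M^a_X, M^b_Y) = Δ(N_X,N_Y) − Σ_a u_X(a)𝟙{N_Y(a) < N_X(a)} + Σ_b u_Y(b)𝟙{N_Y(b) ≤ N_X(b)} − Σ_c π(c,c)𝟙{N_X(c) = N_Y(c)}`. [ours] -/
theorem cdist_expect_eq (hΔ : ∀ N N', Δ N N' = ∑ v, (N v - N' v)) (NX NY : S → ℕ) (MX MY : S → S → ℕ) (π : S → S → ℝ) (uX uY : S → ℝ)
    (hπ0 : ∀ a b, 0 ≤ π a b) (hrow : ∀ a, ∑ b, π a b = uX a) (hcol : ∀ b, ∑ a, π a b = uY b) (htot : ∑ a, uX a = 1)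
    (hMX : ∀ a, uX a ≠ 0 → NX = MX a + Pi.single a 1) (hMY : ∀ b, uY b ≠ 0 → NY = MY b + Pi.single b 1) :
    ∑ a, ∑ b, π a b * (Δ (MX a) (MY b) : ℝ)
      = (Δ NX NY : ℝ) - ∑ a, uX a * (if NY a < NX a then (1 : ℝ) else 0) + ∑ b, uY b * (if NY b ≤ NX b then (1 : ℝ) else 0)
        - ∑ c, π c c * (if NX c = NY c then (1 : ℝ) else 0) := by
  -- pointwise value of the survivors' distance on the support of `π`
  have hval : ∀ a b, π a b * (Δ (MX a) (MY b) : ℝ)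
      = π a b * ((Δ NX NY : ℝ) - (if NY a < NX a then (1 : ℝ) else 0) + (if NY b ≤ NX b then (1 : ℝ) else 0)
          - (if a = b then (if NX a = NY a then (1 : ℝ) else 0) else 0)) := by
    intro a b
    by_cases hz : π a b = 0
    · rw [hz, zero_mul, zero_mul]
    have huX : uX a ≠ 0 := by
      intro h0; rw [← hrow a] at h0
      have := (sum_eq_zero_iff_of_nonneg fun b _ => hπ0 a b).mp h0 b (mem_univ b)
      exact hz this
    have huY : uY b ≠ 0 := by
      intro h0; rw [← hcol b] at h0
      have := (sum_eq_zero_iff_of_nonneg fun a _ => hπ0 a b).mp h0 a (mem_univ a)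
      exact hz this
    have hX := hMX a huX
    have hY := hMY b huY
    congr 1
    by_cases hab : a = b
    · subst hab
      rw [if_pos rfl, hX, hY, cdist_add_single_same hΔ]
      have e1 : (MX a + Pi.single a 1 : S → ℕ) a = MX a a + 1 := by simp
      have e2 : (MY a + Pi.single a 1 : S → ℕ) a = MY a a + 1 := by simp
      rw [e1, e2]
      by_cases h1 : MY a a < MX a a
      · rw [if_pos (by omega), if_pos (by omega), if_neg (by omega)]; ring
      · by_cases h2 : MY a a = MX a a
        · rw [if_neg (by omega), if_pos (by omega), if_pos (by omega)]; ring
        · rw [if_neg (by omega), if_neg (by omega), if_neg (by omega)]; ring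
    · rw [if_neg hab]
      have h := cdist_survivors_int hΔ (MX a) (MY b) hab
      rw [← hX, ← hY] at h
      have ea : NX a = MX a a + 1 := by rw [hX]; simp
      have ea' : NY a = MY b a := by rw [hY]; simp [hab]
      have eb : NX b = MX a b := by rw [hX]; simp [Ne.symm hab]
      have eb' : NY b = MY b b + 1 := by rw [hY]; simp
      have hA : (NY a < NX a) ↔ (MY b a ≤ MX a a) := by rw [ea, ea']; omega
      have hB : (NY b ≤ NX b) ↔ (MY b b + 1 ≤ MX a b) := by rw [eb, eb']
      have hcast : (Δ (MX a) (MY b) : ℝ) = ((Δ (MX a) (MY b) : ℤ) : ℝ) := by norm_cast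
      rw [hcast, h]; push_cast
      rw [sub_zero]
      by_cases c1 : MY b a ≤ MX a a
      · rw [if_pos c1, if_pos (hA.mpr c1)]
        by_cases c2 : MY b b + 1 ≤ MX a b
        · rw [if_pos c2, if_pos (hB.mpr c2)]
        · rw [if_neg c2, if_neg (fun h => c2 (hB.mp h))]
      · rw [if_neg c1, if_neg (fun h => c1 (hA.mp h))]
        by_cases c2 : MY b b + 1 ≤ MX a b
        · rw [if_pos c2, if_pos (hB.mpr c2)]
        · rw [if_neg c2, if_neg (fun h => c2 (hB.mp h))]
  simp_rw [hval, mul_sub, mul_add, mul_sub, Finset.sum_sub_distrib, Finset.sum_add_distrib, Finset.sum_sub_distrib]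
  -- the four sums
  have s1 : ∑ a, ∑ b, π a b * (Δ NX NY : ℝ) = (Δ NX NY : ℝ) := by
    simp_rw [← Finset.sum_mul]
    have : ∑ a, ∑ b, π a b = 1 := by simp_rw [hrow]; exact htot
    rw [this, one_mul]
  have s2 : ∑ a, ∑ b, π a b * (if NY a < NX a then (1 : ℝ) else 0) = ∑ a, uX a * (if NY a < NX a then (1 : ℝ) else 0) := by
    refine sum_congr rfl fun a _ => ?_
    rw [← Finset.sum_mul, hrow]
  have s3 : ∑ a, ∑ b, π a b * (if NY b ≤ NX b then (1 : ℝ) else 0) = ∑ b, uY b * (if NY b ≤ NX b then (1 : ℝ) else 0) := by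
    rw [Finset.sum_comm]
    refine sum_congr rfl fun b _ => ?_
    rw [← Finset.sum_mul, hcol]
  have s4 : ∑ a, ∑ b, π a b * (if a = b then (if NX a = NY a then (1 : ℝ) else 0) else 0)
      = ∑ c, π c c * (if NX c = NY c then (1 : ℝ) else 0) := by
    refine sum_congr rfl fun a _ => ?_
    rw [Finset.sum_eq_single a]
    · rw [if_pos rfl]
    · intro b _ hb; rw [if_neg (Ne.symm hb), mul_zero]
    · intro h; exact absurd (mem_univ a) h
  rw [s1, s2, s3, s4]

end CDist

end Summit.Ventures.LatticeQCDFlow.Scaling
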